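import Summits.BirchSwinnertonDyer.BirchSwinnertonDyer.Theses.SchneiderFreeAdditiveX3Upper
import HarnessLib

/-!
# Route `SchneiderFreeAdditiveX3Upper`: the join `Assembly` (item stmt-BirchSwinnertonDyer-20367)

The route's assembly item (stmt-BirchSwinnertonDyer-20367)
`Summit.BirchSwinnertonDyer.BirchSwinnertonDyer.Theses.SchneiderFreeAdditiveX3Upper.Assembly :=
  PrintedFacts → ControlFacts → GordTwoBranchCoIMCField → PotMultBranchCoIMC → TwistUnitX3OffSliver → Summit.BirchSwinnertonDyer.BirchSwinnertonDyer.Theorems.SchneiderFree.Upper.AdditiveX3RankOneUpper`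
is, literally, the type of the route's planner-authored deciding theorem `Summit.BirchSwinnertonDyer.BirchSwinnertonDyer.Theses.SchneiderFreeAdditiveX3Upper.closes`
(D-0027 §2.1; proved in the route file itself with the standard axioms, its hypotheses being the
route's items and its conclusion the route's registered leaf). Nothing is asserted here: every item of
the chain stays a hypothesis of `Assembly` itself; this file is ONE application of `closes`, closing the
bookkeeping item only. No crux of the route is advanced and BSD is not proved by this.
-/

set_option autoImplicit false
set_option linter.dupNamespace false

namespace Summit.BirchSwinnertonDyer.BirchSwinnertonDyer.Theorems

/-- **The join of route `SchneiderFreeAdditiveX3Upper` holds**: the route's items, taken as hypotheses in the order of the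
assembly chain, imply its leaf `Summit.BirchSwinnertonDyer.BirchSwinnertonDyer.Theorems.SchneiderFree.Upper.AdditiveX3RankOneUpper` — by the route's deciding theorem `closes`, whose type this
literally is. [folklore] -/
theorem schneiderFreeAdditiveX3Upper_assembly_proof :
    Summit.BirchSwinnertonDyer.BirchSwinnertonDyer.Theses.SchneiderFreeAdditiveX3Upper.Assembly :=
  Summit.BirchSwinnertonDyer.BirchSwinnertonDyer.Theses.SchneiderFreeAdditiveX3Upper.closes

end Summit.BirchSwinnertonDyer.BirchSwinnertonDyer.Theorems
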